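import Mathlib.AlgebraicGeometry.Morphisms.Finite
import Mathlib.AlgebraicGeometry.Morphisms.Separated
import Mathlib.AlgebraicGeometry.Morphisms.FiniteType
import Mathlib.RingTheory.AdicCompletion.Algebra
import Mathlib.RingTheory.AdicCompletion.LocalRing
import Mathlib.RingTheory.MvPowerSeries.Basic
import Mathlib.RingTheory.MvPolynomial.Basic
import Mathlib.RingTheory.Polynomial.Basic
import Mathlib.RingTheory.Ideal.MinimalPrime.Basic
import Mathlib.RingTheory.Ideal.Quotient.Operations
import Literature.AlgebraicGeometry.Resolution.ResolutionOfSingularities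
import HarnessLib

/-!
# Teissier presentations (Mourtada–Schober 2025, §3): the structural form of a Teissier singularity

Topic: `Literature/AlgebraicGeometry/Resolution`. Definition request `defn-TeissierPresentation`
(route `TeissierJung` of summit `ResolutionOfSingularities`, items
`stmt-ResolutionOfSingularities-17085` `TeissierReduction` and `…-17086` `TeissierResolve`, which
let-bind the predicate below verbatim as `TF`).

## The notion

Mourtada–Schober [MourtadaSchober2025, Def. 1.2 / Def. 2.3] call an irreducible Weierstrass
hypersurface germ `f ∈ K⟦x₁, …, x_d⟧[z]` (`K` algebraically closed), equipped with the projection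
`(X, 0) → (𝔸^d, 0)`, a TEISSIER SINGULARITY when the last component of the iterated
minimal-polyhedron invariant `κ(π) ∈ (ℚ^d_{≥ 0})^g × {−1, ∞}` (ibid. §2, after
[MourtadaSchober2015]) is `∞`. The opening of ibid. §3 (the display preceding Prop. 3.1) records
the resulting STRUCTURE, which is what the route uses: `(X, 0)` is isomorphic to the subvariety of
`Spec K⟦x⟧[z, u₁, …, u_{g-1}]` cut out by the `g` functions

  `u₁ − (z^{n₁} − c₁ x^{A₁} + h₁(x, z, u₁))`,
  `u₂ − (u₁^{n₂} − c₂ x^{A₂} z^{b₂⁽⁰⁾} + h₂(x, z, u₁, u₂))`, …,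
  `u_{g-1} − (u_{g-2}^{n_{g-1}} − c_{g-1} x^{A_{g-1}} z^{b⁽⁰⁾} u^{b} + h_{g-1})`,
  `u_{g-1}^{n_g} − c_g x^{A_g} z^{b_g⁽⁰⁾} u^{b_g} + h_g(x, z, u₁, …, u_{g-1})`

(the last equation introduces no new variable), where — giving `x_j` the weight `e_j`, `z` the
weight `v₁` and `u_i` the weight `v_{i+1}`, the `v_i ∈ ℚ^d_{≥ 0}` being the components of `κ(π)` —
"the weights of the monomials appearing in the power series `h_i` are larger with respect to the
product ordering than `n_i v_i = weight(u_{i-1}^{n_i}) = weight(x^{A_i} z^{b_i⁽⁰⁾} u^{b_i})`.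
This is an overweight deformation of the ideal generated by the initial binomials" (ibid.;
overweight deformations after [Teissier2014]); moreover `n_i ≥ 2` (ibid. §2: `n₁ > 1`, and
`n > e₁ > e₂ > ⋯ > e_g = 1` with `n_i e_i = e_{i-1}`) and the weights increase, `v_{i+1} > n_i v_i`
(the vertices of the successive weighted characteristic polyhedra, ibid. §2). Of the side conditions
listed under `Teissier.IsDatum` below, the source PRINTS the shape of the equations, the overweight
condition and `n_i > 1`; the remaining normalisations (nonnegative rational vector weights, the
support conditions on `μ_i` and `h_i`, strict monotonicity `n_i v_i < v_{i+1}`, primality of the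
binomial ideal = irreducibility of the toric special fibre, ibid. §1) are exactly those of the
predicate `TF` typed by route `TeissierJung`, which this file factors without change.

## Content

In the variables of the route (`z = u₀` is variable `0 : Fin g`, `u_i` is variable `i`; the `i`-th
equation, `i : Fin g`, reads `u_{i+1} = u_i^{n_i} − c_i x^{A_i} (z,u)^{μ_i} + h_i` for `i + 1 < g`
and `u_{g-1}^{n_{g-1}} − c_{g-1} x^{A_{g-1}} (z,u)^{μ_{g-1}} + h_{g-1} = 0` for the last index):

* `Teissier.weight v a e` — the weight `a + Σ_i e_i • v_i ∈ ℚ^d` of the monomial `x^a (z,u)^e`.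
* `Teissier.core`, `Teissier.equation`, `Teissier.binomial`, `Teissier.ideal`,
  `Teissier.binomialIdeal` — the polynomials `u_i^{n_i} − c_i x^{A_i} (z,u)^{μ_i} + h_i` over
  `K⟦x⟧`, the `g` defining equations, the initial binomials `u_i^{n_i} − c_i x^{A_i} (z,u)^{μ_i}`
  in the polynomial ring `K[x, z, u]`, and the two ideals they span.
* `Teissier.IsDatum n v c A μ h` — the numerical side conditions, exactly as the route states
  them: `n_i ≥ 2`; `c_i ≠ 0`; `v_i ≥ 0`; `μ_i` supported on the variables `u_j`, `j < i`;
  homogeneity `n_i v_i = weight(x^{A_i} (z,u)^{μ_i})`; `n_i v_i < v_{i+1}` in the product order;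
  `h_i` involves no variable beyond `u_{i+1}` and each of its monomials has weight `> n_i v_i`
  (overweight); the binomial ideal is prime (the special fibre of the deformation is the affine
  toric variety of the initial binomials).
* `TeissierPresentation k d B ι` — the ring `B`, with structure map `ι : K⟦x₁, …, x_d⟧ →+* B`, is
  isomorphic over `K⟦x⟧` to `K⟦x⟧[z, u₁, …, u_{g-1}] ⧸ (E₀, …, E_{g-1})` for some Teissier datum.
* `TeissierPresented k X'` — the scheme-level predicate of the route: `X'` is integral and FINITE
  over a regular integral separated finite-type `k`-scheme `S`, and at every closed point `x`,
  for every minimal prime `P` of the completed local ring `𝒪̂_{X',x}`, the analytic branch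
  `𝒪̂_{X',x} ⧸ P` carries a Teissier presentation over an isomorphism `𝒪̂_{S,π x} ≅ K⟦x₁..x_d⟧`,
  compatibly with the stalk map of `π`.
* `teissierPresented_iff` — `TeissierPresented k X'` is equivalent to the let-bound predicate
  `TF X'` of the two route items, whose text is the right-hand side VERBATIM; so a prover converts
  with `(teissierPresented_iff k X').1 h` / `.2 h`.
* `TeissierPresentation.mvPowerSeries` — non-vacuity: `K⟦x₁, …, x_d⟧` over itself is
  Teissier-presented (`g = 0`: a regular point, no equations).

## Sources

* H. Mourtada, B. Schober, *Teissier singularities*, C. R. Math. Acad. Sci. Paris 363 (2025)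
  = arXiv:2502.01239: Def. 1.2, §2 (the invariant `κ(π)`, Thm. 2.2, Def. 2.3, Ex. 2.4), §3 (the
  ideal `I ⊂ K⟦x⟧[z, u₁, …, u_{g-1}]`, display preceding Prop. 3.1; Prop. 3.1, Thm. 3.2).
  [MourtadaSchober2025]
* H. Mourtada, B. Schober, *A polyhedral characterization of quasi-ordinary singularities*,
  arXiv:1512.07507 (the invariant `κ` in characteristic `0`). [MourtadaSchober2015]
* B. Teissier, *Overweight deformations of affine toric varieties and local uniformization*
  (2014). [Teissier2014]

## Design notes

* The presentation is recorded as DATA-EXISTENCE (`∃ g n v c A μ h ψ, …`), not as the output of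
  the `κ`-algorithm: the route needs only the structural form of ibid. §3, and the polyhedral
  invariant `κ(π)` itself (iterated minimal weighted characteristic polyhedra) is a separate,
  larger definition. Nothing here asserts the (announced, [MS1] in preparation) Thm. 3.2.
* `k` is any field and `B` any commutative ring; the route instantiates `k` algebraically closed of
  characteristic `p` and `B = 𝒪̂_{X',x} ⧸ P`.
-/

noncomputable section

open CategoryTheory AlgebraicGeometry TopologicalSpace

namespace Literature.AlgebraicGeometry.Resolution

universe u v

namespace Teissier

variable {k : Type u} [CommRing k] {d g : ℕ}

/-- The weight `a + Σ_i e_i • v_i ∈ ℚ^d` of the monomial `x^a (z,u)^e` when `x_j` has weight the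
`j`-th basis vector and the variable `u_i` (`u₀ = z`) has vector weight `v_i ∈ ℚ^d`.
[cite: MourtadaSchober2025, §3, display preceding Prop. 3.1] -/
def weight (v : Fin g → (Fin d → ℚ)) (a : Fin d →₀ ℕ) (e : Fin g →₀ ℕ) : Fin d → ℚ :=
  fun j => (a j : ℚ) + ∑ i : Fin g, (e i : ℚ) * v i j

/-- Unfolding `Teissier.weight`. [folklore] -/
theorem weight_apply (v : Fin g → (Fin d → ℚ)) (a : Fin d →₀ ℕ) (e : Fin g →₀ ℕ) (j : Fin d) :
    weight v a e j = (a j : ℚ) + ∑ i : Fin g, (e i : ℚ) * v i j := rfl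

/-- The weight of a pure `x`-monomial is its exponent. [folklore] -/
@[simp] theorem weight_zero_right (v : Fin g → (Fin d → ℚ)) (a : Fin d →₀ ℕ) :
    weight v a 0 = fun j => (a j : ℚ) := by
  funext j; simp [weight]

/-- The `i`-th CORE polynomial `u_i^{n_i} − c_i x^{A_i} (z,u)^{μ_i} + h_i ∈ K⟦x⟧[z, u₁, …]`
(`u₀ = z`). [cite: MourtadaSchober2025, §3, display preceding Prop. 3.1] -/
def core (n : Fin g → ℕ) (c : Fin g → k) (A : Fin g → (Fin d →₀ ℕ)) (mu : Fin g → (Fin g →₀ ℕ))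
    (h : Fin g → MvPolynomial (Fin g) (MvPowerSeries (Fin d) k)) (i : Fin g) :
    MvPolynomial (Fin g) (MvPowerSeries (Fin d) k) :=
  MvPolynomial.X i ^ (n i) - MvPolynomial.C (MvPowerSeries.monomial (A i) (c i)) *
    MvPolynomial.monomial (mu i) 1 + h i

/-- The `i`-th DEFINING EQUATION: `u_{i+1} − core_i` when `u_{i+1}` exists (`i + 1 < g`), and
`core_{g-1}` itself for the last index (no new variable).
[cite: MourtadaSchober2025, §3, display preceding Prop. 3.1] -/
def equation (n : Fin g → ℕ) (c : Fin g → k) (A : Fin g → (Fin d →₀ ℕ))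
    (mu : Fin g → (Fin g →₀ ℕ)) (h : Fin g → MvPolynomial (Fin g) (MvPowerSeries (Fin d) k))
    (i : Fin g) : MvPolynomial (Fin g) (MvPowerSeries (Fin d) k) :=
  if hi : i.val + 1 < g then MvPolynomial.X ⟨i.val + 1, hi⟩ - core n c A mu h i
  else core n c A mu h i

/-- The `i`-th INITIAL BINOMIAL `u_i^{n_i} − c_i x^{A_i} (z,u)^{μ_i}` in the polynomial ring
`K[x₁, …, x_d, z, u₁, …, u_{g-1}]` ("the ideal generated by the initial binomials").
[cite: MourtadaSchober2025, §3, display preceding Prop. 3.1] -/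
def binomial (n : Fin g → ℕ) (c : Fin g → k) (A : Fin g → (Fin d →₀ ℕ))
    (mu : Fin g → (Fin g →₀ ℕ)) (i : Fin g) : MvPolynomial (Fin d ⊕ Fin g) k :=
  MvPolynomial.X (Sum.inr i) ^ (n i) - MvPolynomial.C (c i) *
    MvPolynomial.monomial ((A i).sumElim (mu i)) 1

/-- The ideal `(E₀, …, E_{g-1}) ⊂ K⟦x⟧[z, u₁, …, u_{g-1}]` of the presentation.
[cite: MourtadaSchober2025, §3, the ideal `I`] -/
def ideal (n : Fin g → ℕ) (c : Fin g → k) (A : Fin g → (Fin d →₀ ℕ))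
    (mu : Fin g → (Fin g →₀ ℕ)) (h : Fin g → MvPolynomial (Fin g) (MvPowerSeries (Fin d) k)) :
    Ideal (MvPolynomial (Fin g) (MvPowerSeries (Fin d) k)) :=
  Ideal.span (Set.range (equation n c A mu h))

/-- The ideal of `K[x, z, u]` generated by the initial binomials (its zero set is the special
fibre of the overweight deformation). [cite: MourtadaSchober2025, §3] -/
def binomialIdeal (n : Fin g → ℕ) (c : Fin g → k) (A : Fin g → (Fin d →₀ ℕ))
    (mu : Fin g → (Fin g →₀ ℕ)) : Ideal (MvPolynomial (Fin d ⊕ Fin g) k) :=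
  Ideal.span (Set.range (binomial n c A mu))

/-- The numerical conditions on a TEISSIER DATUM `(n, v, c, A, μ, h)` with `g` steps over
`K⟦x₁, …, x_d⟧`, as route `TeissierJung` states them: degrees `n_i ≥ 2`; coefficients `c_i ≠ 0`;
vector weights `v_i ∈ ℚ^d_{≥ 0}`; the exponent `μ_i` of `(z, u)` in the `i`-th binomial involves
only the earlier variables `u_j`, `j < i`; HOMOGENEITY `n_i v_i = weight(x^{A_i} (z,u)^{μ_i})`;
the weights increase STRICTLY in the product order, `n_i v_i < v_{i+1}`; the tail `h_i` involves
no variable beyond `u_{i+1}` and is OVERWEIGHT (every monomial `x^a (z,u)^e` with a nonzero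
coefficient has weight `> n_i v_i` in the product order); and the binomial ideal is prime.
[cite: MourtadaSchober2025, §2 (`n₁ > 1`, `e_g = 1`, the vertices `v_i`) and §3 (display preceding
Prop. 3.1, "overweight deformation of the ideal generated by the initial binomials")] -/
structure IsDatum (n : Fin g → ℕ) (v : Fin g → (Fin d → ℚ)) (c : Fin g → k)
    (A : Fin g → (Fin d →₀ ℕ)) (mu : Fin g → (Fin g →₀ ℕ))
    (h : Fin g → MvPolynomial (Fin g) (MvPowerSeries (Fin d) k)) : Prop where
  /-- `n_i ≥ 2` -/
  two_le : ∀ i, 2 ≤ n i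
  /-- `c_i ≠ 0` -/
  coeff_ne_zero : ∀ i, c i ≠ 0
  /-- `v_i ∈ ℚ^d_{≥ 0}` -/
  weight_nonneg : ∀ i j, 0 ≤ v i j
  /-- `μ_i` only involves the variables `u_j` with `j < i` -/
  mu_eq_zero : ∀ i (j : Fin g), i.val ≤ j.val → mu i j = 0
  /-- homogeneity of the `i`-th binomial: `n_i v_i = A_i + Σ_j μ_{ij} v_j` -/
  homogeneous : ∀ i, n i • v i = weight v (A i) (mu i)
  /-- `n_i v_i < v_{i+1}` in the product order on `ℚ^d` -/
  weight_lt : ∀ (i : Fin g) (hi : i.val + 1 < g),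
    n i • v i ≤ v ⟨i.val + 1, hi⟩ ∧ n i • v i ≠ v ⟨i.val + 1, hi⟩
  /-- `h_i ∈ K⟦x⟧[u₀, …, u_{i+1}]` and every monomial of `h_i` has weight `> n_i v_i` -/
  overweight : ∀ i, ∀ e ∈ (h i).support, (∀ j : Fin g, i.val + 1 < j.val → e j = 0) ∧
    ∀ a : Fin d →₀ ℕ, MvPowerSeries.coeff a ((h i).coeff e) ≠ 0 →
      n i • v i ≤ weight v a e ∧ n i • v i ≠ weight v a e
  /-- the ideal of initial binomials is prime (toric special fibre) -/
  isPrime : (binomialIdeal n c A mu).IsPrime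

end Teissier

/-- **Teissier presentation** of a ring `B` over the power series ring `K⟦x₁, …, x_d⟧` (structure
map `ι`): for some `g`, some Teissier datum `(n, v, c, A, μ, h)` (`Teissier.IsDatum`) and some ring
isomorphism `ψ : B ≃ K⟦x⟧[z, u₁, …, u_{g-1}] ⧸ (E₀, …, E_{g-1})` (`Teissier.ideal`) compatible with
`ι` and the inclusion of constants — the structural form of a Teissier singularity
`(X, 0) → (𝔸^d, 0)`: "an overweight deformation of the ideal generated by the initial binomials".
[cite: MourtadaSchober2025, §3, display preceding Prop. 3.1; Def. 2.3] -/
def TeissierPresentation (k : Type u) [Field k] (d : ℕ) (B : Type v) [CommRing B]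
    (ι : MvPowerSeries (Fin d) k →+* B) : Prop :=
  ∃ (g : ℕ) (n : Fin g → ℕ) (v : Fin g → (Fin d → ℚ)) (c : Fin g → k) (A : Fin g → (Fin d →₀ ℕ))
    (mu : Fin g → (Fin g →₀ ℕ)) (h : Fin g → MvPolynomial (Fin g) (MvPowerSeries (Fin d) k)),
    Teissier.IsDatum n v c A mu h ∧
      ∃ ψ : B ≃+* (MvPolynomial (Fin g) (MvPowerSeries (Fin d) k) ⧸ Teissier.ideal n c A mu h),
        ∀ a, ψ (ι a) = Ideal.Quotient.mk _ (MvPolynomial.C a)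

/-- **Teissier-presented scheme** over the field `k` (the predicate `TF` of route `TeissierJung`):
`X'` is integral and FINITE over a regular, integral, separated `k`-scheme `S` of finite type, and
for every closed point `x ∈ X'` and every minimal prime `P` of the completed local ring
`𝒪̂_{X',x}`, the analytic branch `𝒪̂_{X',x} ⧸ P` carries a Teissier presentation over some
isomorphism `𝒪̂_{S,π(x)} ≅ K⟦x₁, …, x_d⟧`, compatibly with the stalk map of `π : X' → S` — the
global form ("finite over a regular base, every branch at every closed point a Teissier
singularity over the base") of [cite: MourtadaSchober2025, Def. 2.3 and §3]. -/
def TeissierPresented (k : Type u) [Field k] (X' : Scheme.{u}) : Prop :=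
  ∃ (S : Scheme.{u}) (g : S ⟶ Spec (.of k)) (π : X' ⟶ S),
    IsSeparated g ∧ LocallyOfFiniteType g ∧ QuasiCompact g ∧ IsIntegral S ∧ Scheme.IsRegular S ∧
    IsIntegral X' ∧ IsFinite π ∧
    ∀ x : X', IsClosed ({x} : Set X') →
      ∀ P ∈ minimalPrimes
          (AdicCompletion (IsLocalRing.maximalIdeal (X'.presheaf.stalk x)) (X'.presheaf.stalk x)),
        ∃ (d : ℕ)
          (φ : AdicCompletion (IsLocalRing.maximalIdeal (S.presheaf.stalk (π.base x)))
              (S.presheaf.stalk (π.base x)) ≃+* MvPowerSeries (Fin d) k)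
          (ι : MvPowerSeries (Fin d) k →+*
            AdicCompletion (IsLocalRing.maximalIdeal (X'.presheaf.stalk x)) (X'.presheaf.stalk x) ⧸ P),
          TeissierPresentation k d _ ι ∧
            ∀ a : S.presheaf.stalk (π.base x),
              ι (φ (algebraMap _ _ a)) = Ideal.Quotient.mk P (algebraMap _ _ ((π.stalkMap x).hom a))

/-! ## API -/

/-- A Teissier-presented scheme is integral. [folklore] -/
theorem TeissierPresented.isIntegral {k : Type u} [Field k] {X' : Scheme.{u}}
    (h : TeissierPresented k X') : IsIntegral X' := by
  obtain ⟨_, _, _, _, _, _, _, _, hX, _, _⟩ := h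
  exact hX

/-- A Teissier-presented scheme is finite over a regular integral separated `k`-scheme of finite
type. [folklore] -/
theorem TeissierPresented.exists_isFinite {k : Type u} [Field k] {X' : Scheme.{u}}
    (h : TeissierPresented k X') :
    ∃ (S : Scheme.{u}) (g : S ⟶ Spec (.of k)) (π : X' ⟶ S), IsSeparated g ∧
      LocallyOfFiniteType g ∧ QuasiCompact g ∧ IsIntegral S ∧ Scheme.IsRegular S ∧ IsFinite π := by
  obtain ⟨S, g, π, h1, h2, h3, h4, h5, _, h7, _⟩ := h
  exact ⟨S, g, π, h1, h2, h3, h4, h5, h7⟩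

/-- Transport of a Teissier presentation along a ring isomorphism under `K⟦x⟧`. [folklore] -/
theorem TeissierPresentation.of_ringEquiv {k : Type u} [Field k] {d : ℕ} {B : Type v} [CommRing B]
    {B' : Type*} [CommRing B'] {ι : MvPowerSeries (Fin d) k →+* B}
    (h : TeissierPresentation k d B ι) (e : B ≃+* B') :
    TeissierPresentation k d B' (e.toRingHom.comp ι) := by
  obtain ⟨g, n, v, c, A, mu, h, hD, ψ, hψ⟩ := h
  refine ⟨g, n, v, c, A, mu, h, hD, e.symm.trans ψ, fun a => ?_⟩
  simp [hψ]

/-- Non-vacuity: `K⟦x₁, …, x_d⟧` is Teissier-presented over itself, with `g = 0` (no equations;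
the binomial ideal is `⊥`, prime since `K[x]` is a domain) — the case of a regular point.
[folklore] -/
theorem TeissierPresentation.mvPowerSeries (k : Type u) [Field k] (d : ℕ) :
    TeissierPresentation k d (MvPowerSeries (Fin d) k) (RingHom.id _) := by
  have hI : Teissier.ideal (k := k) (d := d) (g := 0) Fin.elim0 Fin.elim0 Fin.elim0 Fin.elim0
      Fin.elim0 = ⊥ := by
    simp [Teissier.ideal, Set.range_eq_empty]
  have hB : Teissier.binomialIdeal (k := k) (d := d) (g := 0) Fin.elim0 Fin.elim0 Fin.elim0
      Fin.elim0 = ⊥ := by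
    simp [Teissier.binomialIdeal, Set.range_eq_empty]
  refine ⟨0, Fin.elim0, Fin.elim0, Fin.elim0, Fin.elim0, Fin.elim0, Fin.elim0,
    ⟨fun i => i.elim0, fun i => i.elim0, fun i => i.elim0, fun i => i.elim0, fun i => i.elim0,
      fun i => i.elim0, fun i => i.elim0, ?_⟩, ?_⟩
  · rw [hB]; exact Ideal.isPrime_bot
  · refine ⟨(MvPolynomial.isEmptyAlgEquiv (MvPowerSeries (Fin d) k) (Fin 0)).symm.toRingEquiv.trans
      ((Ideal.quotEquivOfEq hI).trans (RingEquiv.quotientBot _)).symm, fun a => ?_⟩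
    simp

/-! ## The bridge to route `TeissierJung`

The right-hand side below is, byte for byte, the body of the predicate `TF` that the route items
`TeissierReduction` (stmt-ResolutionOfSingularities-17085) and `TeissierResolve` (…-17086) let-bind. -/

/-- `TeissierPresented k X'` unfolds to the predicate `TF X'` of route `TeissierJung` (verbatim):
the only repackaging is that the route asks for the compatibility of `ψ` with `π` on the image of
`𝒪_{S,π x}`, while `TeissierPresented` names the structure map `ι : K⟦x⟧ → 𝒪̂_{X',x} ⧸ P`
(necessarily `ι = ψ⁻¹ ∘ (constants)`). [folklore] -/
theorem teissierPresented_iff (k : Type u) [Field k] (X' : Scheme.{u}) :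
    TeissierPresented k X' ↔
      (∃ (S : AlgebraicGeometry.Scheme.{u}) (g : S ⟶ AlgebraicGeometry.Spec (.of k)) (π : X' ⟶ S), AlgebraicGeometry.IsSeparated g ∧ AlgebraicGeometry.LocallyOfFiniteType g ∧ AlgebraicGeometry.QuasiCompact g ∧ AlgebraicGeometry.IsIntegral S ∧ Literature.AlgebraicGeometry.Resolution.Scheme.IsRegular S ∧ AlgebraicGeometry.IsIntegral X' ∧ AlgebraicGeometry.IsFinite π ∧ ∀ x : X', IsClosed ({x} : Set X') → ∀ P ∈ minimalPrimes (AdicCompletion (IsLocalRing.maximalIdeal (X'.presheaf.stalk x)) (X'.presheaf.stalk x)), ∃ (d g : ℕ) (n : Fin g → ℕ) (v : Fin g → (Fin d → ℚ)) (c : Fin g → k) (A : Fin g → (Fin d →₀ ℕ)) (mu : Fin g → (Fin g →₀ ℕ)) (h : Fin g → MvPolynomial (Fin g) (MvPowerSeries (Fin d) k)) (φ : AdicCompletion (IsLocalRing.maximalIdeal (S.presheaf.stalk (π.base x))) (S.presheaf.stalk (π.base x)) ≃+* MvPowerSeries (Fin d) k), let W : (Fin d →₀ ℕ) → (Fin g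 →₀ ℕ) → (Fin d → ℚ) := fun a e j => (a j : ℚ) + ∑ i : Fin g, (e i : ℚ) * v i j; let core : Fin g → MvPolynomial (Fin g) (MvPowerSeries (Fin d) k) := fun i => MvPolynomial.X i ^ (n i) - MvPolynomial.C (MvPowerSeries.monomial (A i) (c i)) * MvPolynomial.monomial (mu i) 1 + h i; let E : Fin g → MvPolynomial (Fin g) (MvPowerSeries (Fin d) k) := fun i => if hi : i.val + 1 < g then MvPolynomial.X ⟨i.val + 1, hi⟩ - core i else core i; let B : Fin g → MvPolynomial (Fin d ⊕ Fin g) k := fun i => MvPolynomial.X (Sum.inr i) ^ (n i) - MvPolynomial.C (c i) * MvPolynomial.monomial ((A i).sumElim (mu i)) 1; ∃ ψ : (AdicCompletion (IsLocalRing.maximalIdeal (X'.presheaf.stalk x)) (X'.presheaf.stalk x) ⧸ P) ≃+* (MvPolynomial (Fin g) (MvPowerSeries (Fin d) k) ⧸ Ideal.span (Set.range E)), (∀ i, 2 ≤ n i) ∧ (∀ i, c i ≠ 0) ∧ (∀ i j, 0 ≤ v i j) ∧ (∀ i (j : Fin g), i.val ≤ j.val → mu i j = 0) ∧ (∀ i,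 n i • v i = W (A i) (mu i)) ∧ (∀ (i : Fin g) (hi : i.val + 1 < g), n i • v i ≤ v ⟨i.val + 1, hi⟩ ∧ n i • v i ≠ v ⟨i.val + 1, hi⟩) ∧ (∀ i, ∀ e ∈ (h i).support, (∀ j : Fin g, i.val + 1 < j.val → e j = 0) ∧ ∀ a : Fin d →₀ ℕ, MvPowerSeries.coeff a ((h i).coeff e) ≠ 0 → n i • v i ≤ W a e ∧ n i • v i ≠ W a e) ∧ (Ideal.span (Set.range B)).IsPrime ∧ (∀ a : S.presheaf.stalk (π.base x), ψ (Ideal.Quotient.mk P (algebraMap _ _ ((π.stalkMap x).hom a))) = Ideal.Quotient.mk _ (MvPolynomial.C (φ (algebraMap _ _ a))))) := by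
  refine exists_congr fun S => exists_congr fun g => exists_congr fun π => ?_
  refine and_congr_right fun _ => and_congr_right fun _ => and_congr_right fun _ =>
    and_congr_right fun _ => and_congr_right fun _ => and_congr_right fun _ =>
    and_congr_right fun _ => ?_
  refine forall_congr' fun x => forall_congr' fun _ => forall_congr' fun P =>
    forall_congr' fun _ => ?_
  constructor
  · rintro ⟨d, φ, ι, ⟨g', n, v, c, A, mu, h, hD, ψ, hψ⟩, hι⟩
    refine ⟨d, g', n, v, c, A, mu, h, φ, ψ, hD.two_le, hD.coeff_ne_zero, hD.weight_nonneg,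
      hD.mu_eq_zero, hD.homogeneous, hD.weight_lt, hD.overweight, hD.isPrime, fun a => ?_⟩
    have key := hψ (φ (algebraMap _ _ a))
    rw [hι a] at key
    exact key
  · rintro ⟨d, g', n, v, c, A, mu, h, φ, ψ, h1, h2, h3, h4, h5, h6, h7, h8, hcomp⟩
    refine ⟨d, φ, ψ.symm.toRingHom.comp ((Ideal.Quotient.mk _).comp MvPolynomial.C),
      ⟨g', n, v, c, A, mu, h, ⟨h1, h2, h3, h4, h5, h6, h7, h8⟩, ψ, fun a => ?_⟩, fun a => ?_⟩
    · simp only [RingHom.coe_comp, RingEquiv.toRingHom_eq_coe, RingHom.coe_coe,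
        Function.comp_apply]
      exact ψ.apply_symm_apply _
    · simp only [RingHom.coe_comp, RingEquiv.toRingHom_eq_coe, RingHom.coe_coe,
        Function.comp_apply]
      rw [RingEquiv.symm_apply_eq, hcomp]

end Literature.AlgebraicGeometry.Resolution
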